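import Summits.CriticalPhenomena.PercolationContinuityZ3.Theorems.PercNearOneGluingNoHeavyLowerTailSunflowerTBernZOne
import HarnessLib

/-!
# `NoHeavyLowerTail` (crux stmt-CriticalPhenomena-4575), abstract sunflower cubic: T-BERN — the EXACT absorption state and the
# h-endgame ★ (the remaining obligation, packaged)

Support file (seat `prim-ineq-prove-1` gen 63; `--supports stmt-CriticalPhenomena-4575`).  No `sorry`, no named facts.
Memo: run/shared/lean/prim/prim-ineq-prove-1/FINDING-CONVEX-prove1-g63.md §3(β), §5.

`…SunflowerTBernZOne` runs the sequential scheme with the CRUDE state `(α(X_run), ∏γ)`; that suffices without `vv`-leverage but not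
for the final step with an h-petal `(1, γ_h)`, whose misalignment `(A − G)(γ_h − 1)` must be paid from the `A`-room `ᾱ − A` and the
`g`-slack `Y − Gγ_h`.  Here the γ-heavy x-type petals are absorbed with the MINIMAL inflation (`zone_extend_exact`): starting from a
state `(A, G)` (`G ≥ 1`, `A ≤ α(X₀)`), after the petals `W` the state is
  `G_W = G·∏_W γ_j`,  `A_W = G_W·S_W`,  `S_W = A/G − Σ_{j∈W} d_j`,  `d_j = (γ_j − α_j)/γ_j`   (valid while `S_W ≥ 1`),
and still `A_W ≤ α(X₀·∏_W x_j)`.  **`coefDom_insert_h_of_star`**: one more petal `h` with `α_h = 1 ≤ γ_h` is absorbed into the FINAL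
target `(X+1)^(n−1)(ĀX + Ȳ)` as soon as `A_W ≤ Ā`, `G_Wγ_h ≤ Ȳ` and
  ★  `A_W·γ_h + G_W ≤ Ā + Ȳ`.
With `Ā = 1/A₀`, `Ȳ = V/a₀` (normalised `ᾱ`, `Y`) this is the endgame of the memo: numerically ★ holds for every admissible
{hub, pack, h} family (0 violations, incl. the region where the virtual-pack endgame fails); its proof is the open item.
-/

noncomputable section

namespace Summit.CriticalPhenomena.PercolationContinuityZ3.Theorems.SunflowerPartition

namespace SafeCalc

namespace LinkedCurrency

open Finset Polynomial

variable {ι : Type*} [DecidableEq ι]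

/-- **Exact absorption of γ-heavy x-type petals.**  See the module docstring. [this work] -/
theorem zone_extend_exact {κ : ℝ} (hκ0 : 0 ≤ κ) (x γ : ι → ℝ) (t₀ : Finset ι) (ht₀ : t₀.Nonempty)
    {X₀ A G : ℝ} (hX₀ : 1 ≤ X₀) (hG : 1 ≤ G) (hA : A ≤ 1 + κ * (X₀ - 1))
    (hdom : CoefDom (prodPoly t₀ (fun j => 1 + κ * (x j - 1)) γ)
      ((C 1 * X + C 1) ^ (t₀.card - 1) * (C A * X + C G)))
    (W : Finset ι) (hW : Disjoint t₀ W) (hx : ∀ j ∈ W, 1 ≤ x j) (hγx : ∀ j ∈ W, γ j ≤ x j)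
    (hg : ∀ j ∈ W, 1 + κ * (x j - 1) ≤ γ j)
    (hS : 1 ≤ A / G - ∑ j ∈ W, (γ j - (1 + κ * (x j - 1))) / γ j) :
    CoefDom (prodPoly (t₀ ∪ W) (fun j => 1 + κ * (x j - 1)) γ)
        ((C 1 * X + C 1) ^ ((t₀ ∪ W).card - 1) *
          (C ((G * ∏ j ∈ W, γ j) * (A / G - ∑ j ∈ W, (γ j - (1 + κ * (x j - 1))) / γ j)) * X +
            C (G * ∏ j ∈ W, γ j))) ∧
      (G * ∏ j ∈ W, γ j) * (A / G - ∑ j ∈ W, (γ j - (1 + κ * (x j - 1))) / γ j) ≤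
          1 + κ * (X₀ * ∏ j ∈ W, x j - 1) ∧
      1 ≤ G * ∏ j ∈ W, γ j ∧ 1 ≤ X₀ * ∏ j ∈ W, x j := by
  classical
  have hGpos : 0 < G := zero_lt_one.trans_le hG
  induction W using Finset.induction_on with
  | empty =>
    refine ⟨?_, ?_, ?_, ?_⟩
    · simpa [mul_div_cancel₀ A hGpos.ne'] using hdom
    · simpa [mul_div_cancel₀ A hGpos.ne'] using hA
    · simpa using hG
    · simpa using hX₀
  | @insert j W hjW ih =>
    have hdis : Disjoint t₀ W := Disjoint.mono_right (subset_insert j W) hW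
    have hjt : j ∉ t₀ := fun h => (disjoint_left.1 hW) h (mem_insert_self j W)
    have hj : j ∉ t₀ ∪ W := by rw [mem_union, not_or]; exact ⟨hjt, hjW⟩
    have hxj : 1 ≤ x j := hx j (mem_insert_self j W)
    have hγxj : γ j ≤ x j := hγx j (mem_insert_self j W)
    have hgj : 1 + κ * (x j - 1) ≤ γ j := hg j (mem_insert_self j W)
    have hαj1 : 1 ≤ 1 + κ * (x j - 1) := by nlinarith
    have hγj1 : 1 ≤ γ j := hαj1.trans hgj
    have hγj0 : 0 < γ j := zero_lt_one.trans_le hγj1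
    have hdj0 : 0 ≤ (γ j - (1 + κ * (x j - 1))) / γ j := div_nonneg (sub_nonneg.2 hgj) hγj0.le
    rw [sum_insert hjW] at hS
    have hS' : 1 ≤ A / G - ∑ i ∈ W, (γ i - (1 + κ * (x i - 1))) / γ i := by linarith
    obtain ⟨key, hAW, hGW, hXW⟩ := ih hdis (fun i hi => hx i (mem_insert_of_mem hi))
      (fun i hi => hγx i (mem_insert_of_mem hi)) (fun i hi => hg i (mem_insert_of_mem hi)) hS'
    -- names for the running state
    set GW := G * ∏ i ∈ W, γ i with hGWd
    set XW := X₀ * ∏ i ∈ W, x i with hXWd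
    set SW := A / G - ∑ i ∈ W, (γ i - (1 + κ * (x i - 1))) / γ i with hSWd
    have hGW0 : 0 ≤ GW := zero_le_one.trans hGW
    have hAG : GW ≤ GW * SW := by nlinarith
    -- the new state
    have hprodγ : G * ∏ i ∈ insert j W, γ i = GW * γ j := by rw [prod_insert hjW]; ring
    have hprodx : X₀ * ∏ i ∈ insert j W, x i = XW * x j := by rw [prod_insert hjW]; ring
    have hsum : A / G - ∑ i ∈ insert j W, (γ i - (1 + κ * (x i - 1))) / γ i =
        SW - (γ j - (1 + κ * (x j - 1))) / γ j := by rw [sum_insert hjW]; ring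
    have hnewA : (GW * γ j) * (SW - (γ j - (1 + κ * (x j - 1))) / γ j) =
        (GW * SW) * γ j - GW * (γ j - (1 + κ * (x j - 1))) := by
      field_simp
    have hne : (t₀ ∪ W).Nonempty := ht₀.mono subset_union_left
    rw [union_insert, hprodγ, hprodx, hsum, hnewA]
    refine ⟨?_, ?_, ?_, ?_⟩
    · refine coefDom_prodPoly_insert hj hne zero_le_one zero_le_one (zero_le_one.trans hαj1) hγj0.le key ?_ ?_ ?_
      · -- A_W α_j ≤ A' ⟺ (A_W − G_W)(γ_j − α_j) ≥ 0
        nlinarith [mul_nonneg (sub_nonneg.2 hAG) (sub_nonneg.2 hgj)]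
      · rw [one_mul]
      · nlinarith
    · -- A' ≤ α(XW x_j), by the x-step with A_W ≤ α(XW)
      have h1 := xstep_le hκ0 hXW hGW hgj hγxj
      have h2 : (GW * SW) * γ j ≤ (1 + κ * (XW - 1)) * γ j := mul_le_mul_of_nonneg_right hAW hγj0.le
      nlinarith
    · nlinarith
    · nlinarith

/-- **The h-endgame ★, packaged.**  After the exact absorption, ONE petal `h ∉ t₀ ∪ W` with `α_h = 1 ≤ γ_h` (an h-petal: `x_h = 1`) is
absorbed into the final target `(X+1)^n (ĀX + Ȳ)` provided `A_W ≤ Ā`, `G_W·γ_h ≤ Ȳ` and ★ `A_W·γ_h + G_W ≤ Ā + Ȳ`. [this work] -/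
theorem coefDom_insert_h_of_star {a c : ι → ℝ} {t : Finset ι} (ht : t.Nonempty) {h : ι} (hh : h ∉ t) {AW GW Abar Ybar : ℝ}
    (hdom : CoefDom (prodPoly t a c) ((C 1 * X + C 1) ^ (t.card - 1) * (C AW * X + C GW)))
    (hah : a h = 1) (hch : 0 ≤ c h) (hA : AW ≤ Abar) (hG : GW * c h ≤ Ybar) (hstar : AW * c h + GW ≤ Abar + Ybar) :
    CoefDom (prodPoly (insert h t) a c) ((C 1 * X + C 1) ^ ((insert h t).card - 1) * (C Abar * X + C Ybar)) := by
  refine coefDom_prodPoly_insert hh ht zero_le_one zero_le_one (by rw [hah]; exact zero_le_one) hch hdom ?_ ?_ ?_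
  · rw [hah, mul_one, one_mul]; exact hA
  · rw [one_mul]; exact hG
  · rw [hah, mul_one, one_mul, one_mul]; linarith

end LinkedCurrency

end SafeCalc

end Summit.CriticalPhenomena.PercolationContinuityZ3.Theorems.SunflowerPartition
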